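import Literature.Analysis.Distribution.FourierLaplaceTransform
import HarnessLib

/-!
# Continuity and growth of the Fourier–Laplace kernel along real directions

Topic `Literature/Analysis/Distribution`. Fifth brick of the proof of
`fourierLaplace_coneSupport` (`FourierLaplaceCone`): the input needed to exchange the tempered
distribution `u = T ∘ 𝓕⁻¹` with the `x`-integral in the boundary-value pairing
`∫ F(x + ity) φ(x) dx = ∫ u(χ_S e^{−2πi⟨x+ity, ·⟩}) φ(x) dx` (Streater–Wightman (1964), proof of
Thm. 2-9: "`exp(−p·η)T` is a continuous function of `η` with values in `𝒮'`"; here on the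
test-function side). For the Schwartz kernel `laplaceKernel S z` (`FourierLaplaceTransform`):

* `norm_iteratedFDeriv_cutoff_cexp_sub_le`: the first-order difference estimate
  `‖Dⁿ(χ eˡ (e^{ℓ'} − 1))(x)‖ ≤ 4ⁿ B (1+‖ℓ‖)ⁿ eᴬ ‖ℓ'‖ (1+‖x‖) e^{−(c/2)‖x‖}`;
* `exists_seminorm_laplaceKernel_sub_le`: `z ↦ laplaceKernel S z` is locally Lipschitz into
  every Schwartz seminorm on the tube, `‖K(z+w) − K(z)‖_{k,n} ≤ K_{k,n} ‖w‖`;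
* `continuous_laplaceKernel_rayPoint`: for `y` in the open cone and `t > 0`,
  `x ↦ laplaceKernel S (x + ity)` is continuous into `𝓢(ℝ^ι, ℂ)`;
* `exists_seminorm_laplaceKernel_rayPoint_le`: its seminorms grow polynomially in `x`.

All [folklore] estimates on top of `ConeCutoffEstimates` / `FourierLaplaceTransform`.

## References

* R. F. Streater, A. S. Wightman, *PCT, Spin and Statistics, and All That*, §2-3, proof of
  Thm. 2-9 (pdf p. 56 of the 2000 printing). [StreaterWightman1964]
-/

noncomputable section

open Set Filter Metric SchwartzMap
open _root_.Complex (exp I)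
open scoped ContDiff Topology RealInnerProductSpace SchwartzMap

namespace Literature.Analysis.Distribution

/-! ### The first-order difference estimate -/

section Kernel

variable {V : Type*} [NormedAddCommGroup V] [NormedSpace ℝ V]

/-- **First-order difference estimate**: with `χ`, `ℓ` as in `norm_iteratedFDeriv_cutoff_cexp_le`
and `‖ℓ'‖ ≤ min 1 (c/2)`,
`‖Dⁿ(χ eˡ (e^{ℓ'} − 1))(x)‖ ≤ 4ⁿ B (1+‖ℓ‖)ⁿ eᴬ ‖ℓ'‖ (1+‖x‖) e^{−(c/2)‖x‖}`. [folklore] -/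
theorem norm_iteratedFDeriv_cutoff_cexp_sub_le {χ : V → ℝ} (hχ : ContDiff ℝ ∞ χ) {n : ℕ}
    {B : ℝ} (hB : ∀ i ≤ n, ∀ x, ‖iteratedFDeriv ℝ i χ x‖ ≤ B) (ℓ : V →L[ℝ] ℂ) {c A : ℝ}
    (hℓ : ∀ x ∈ tsupport χ, (ℓ x).re ≤ A - c * ‖x‖) (ℓ' : V →L[ℝ] ℂ) (hℓ'1 : ‖ℓ'‖ ≤ 1)
    (hℓ'c : ‖ℓ'‖ ≤ c / 2) (x : V) :
    ‖iteratedFDeriv ℝ n (fun y => (χ y : ℂ) * exp (ℓ y) * (exp (ℓ' y) - 1)) x‖ ≤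
      4 ^ n * B * (1 + ‖ℓ‖) ^ n * Real.exp A * ‖ℓ'‖ * (1 + ‖x‖) * Real.exp (-(c / 2 * ‖x‖)) := by
  have hB0 : 0 ≤ B := (norm_nonneg _).trans (hB 0 (Nat.zero_le _) x)
  have hc2 : 0 ≤ c / 2 := (norm_nonneg _).trans hℓ'c
  have h1 : ∀ i ≤ n, ‖iteratedFDeriv ℝ i (fun y => (χ y : ℂ) * exp (ℓ y)) x‖ ≤
      2 ^ n * B * (1 + ‖ℓ‖) ^ n * Real.exp A * Real.exp (-(c * ‖x‖)) := by
    intro i hi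
    refine (norm_iteratedFDeriv_cutoff_cexp_le hχ (fun j hj => hB j (hj.trans hi)) ℓ hℓ x).trans ?_
    have h2i : (2 : ℝ) ^ i ≤ 2 ^ n := pow_le_pow_right₀ (by norm_num) hi
    have hli : (1 + ‖ℓ‖) ^ i ≤ (1 + ‖ℓ‖) ^ n :=
      pow_le_pow_right₀ (by linarith [norm_nonneg ℓ]) hi
    gcongr
  have hmax : Real.exp (max (ℓ' x).re 0) ≤ Real.exp (c / 2 * ‖x‖) := by
    refine Real.exp_le_exp.2 (max_le ?_ (mul_nonneg hc2 (norm_nonneg _)))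
    calc (ℓ' x).re ≤ ‖ℓ' x‖ := Complex.re_le_norm _
      _ ≤ ‖ℓ'‖ * ‖x‖ := ℓ'.le_opNorm x
      _ ≤ c / 2 * ‖x‖ := by gcongr
  have h2 : ∀ i ≤ n, ‖iteratedFDeriv ℝ i (fun y => exp (ℓ' y) - 1) x‖ ≤
      ‖ℓ'‖ * (1 + ‖x‖) * Real.exp (c / 2 * ‖x‖) := by
    intro i _
    refine (norm_iteratedFDeriv_cexp_comp_sub_one_le ℓ' i x).trans ?_
    split_ifs with hi0
    · calc ‖ℓ' x‖ * Real.exp (max (ℓ' x).re 0) ≤ ‖ℓ'‖ * ‖x‖ * Real.exp (c / 2 * ‖x‖) := by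
            gcongr
            exact ℓ'.le_opNorm x
        _ ≤ ‖ℓ'‖ * (1 + ‖x‖) * Real.exp (c / 2 * ‖x‖) := by
            gcongr; linarith [norm_nonneg x]
    · calc ‖ℓ'‖ ^ i * Real.exp (max (ℓ' x).re 0) ≤ ‖ℓ'‖ * Real.exp (c / 2 * ‖x‖) := by
            gcongr
            calc ‖ℓ'‖ ^ i ≤ ‖ℓ'‖ ^ 1 :=
                  pow_le_pow_of_le_one (norm_nonneg _) hℓ'1 (Nat.one_le_iff_ne_zero.2 hi0)
              _ = ‖ℓ'‖ := pow_one _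
        _ ≤ ‖ℓ'‖ * (1 + ‖x‖) * Real.exp (c / 2 * ‖x‖) := by
            gcongr
            exact le_mul_of_one_le_right (norm_nonneg _) (by linarith [norm_nonneg x])
  have hf : ContDiff ℝ ∞ fun y => (χ y : ℂ) * exp (ℓ y) := contDiff_cutoff_cexp hχ ℓ
  have hg : ContDiff ℝ ∞ fun y => exp (ℓ' y) - 1 := (contDiff_cexp_comp ℓ').sub contDiff_const
  calc ‖iteratedFDeriv ℝ n (fun y => (χ y : ℂ) * exp (ℓ y) * (exp (ℓ' y) - 1)) x‖
      ≤ 2 ^ n * (2 ^ n * B * (1 + ‖ℓ‖) ^ n * Real.exp A * Real.exp (-(c * ‖x‖))) *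
          (‖ℓ'‖ * (1 + ‖x‖) * Real.exp (c / 2 * ‖x‖)) :=
        norm_iteratedFDeriv_mul_le_of_le hf hg h1 h2
    _ = 4 ^ n * B * (1 + ‖ℓ‖) ^ n * Real.exp A * ‖ℓ'‖ * (1 + ‖x‖) *
          (Real.exp (-(c * ‖x‖)) * Real.exp (c / 2 * ‖x‖)) := by
        rw [show (4 : ℝ) ^ n = 2 ^ n * 2 ^ n by rw [← mul_pow]; norm_num]
        ring
    _ = 4 ^ n * B * (1 + ‖ℓ‖) ^ n * Real.exp A * ‖ℓ'‖ * (1 + ‖x‖) *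
          Real.exp (-(c / 2 * ‖x‖)) := by
        rw [← Real.exp_add]
        congr 2
        ring

end Kernel

variable {ι : Type*} [Fintype ι]

/-! ### Local Lipschitz continuity of the kernel in every seminorm -/

/-- **The kernel is locally Lipschitz into every Schwartz seminorm on the tube**: for `Im z` in
the open cone there is `ρ > 0` such that `Im (z + w)` stays in the cone for `‖w‖ ≤ ρ` and
`‖laplaceKernel S (z+w) − laplaceKernel S z‖_{k,n} ≤ K_{k,n} ‖w‖`. [folklore] -/
theorem exists_seminorm_laplaceKernel_sub_le (S : Set (EuclideanSpace ℝ ι)) {z : ι → ℂ}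
    (hz : imVec z ∈ interior (polarCone S)) :
    ∃ ρ : ℝ, 0 < ρ ∧ (∀ w : ι → ℂ, ‖w‖ ≤ ρ → imVec (z + w) ∈ interior (polarCone S)) ∧
      ∀ m : ℕ × ℕ, ∃ K : ℝ, 0 ≤ K ∧ ∀ w : ι → ℂ, ‖w‖ ≤ ρ →
        SchwartzMap.seminorm ℂ m.1 m.2 (laplaceKernel S (z + w) - laplaceKernel S z) ≤ K * ‖w‖ := by
  -- a compact ball of imaginary parts inside the open cone
  obtain ⟨ρ, hρ, hball⟩ := nhds_basis_closedBall.mem_iff.1 (isOpen_interior.mem_nhds hz)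
  set M : Set (EuclideanSpace ℝ ι) := closedBall (imVec z) ρ with hM
  have hMc : IsCompact M := isCompact_closedBall _ _
  have hzM : imVec z ∈ M := mem_closedBall_self hρ.le
  obtain ⟨c, A, hc, hre⟩ := exists_re_expForm_le S hMc hball
  set κ : ℝ := 2 * Real.pi * Fintype.card ι with hκ
  have hκ0 : 0 ≤ κ := by positivity
  have hκw : ∀ w : ι → ℂ, ‖expForm w‖ ≤ κ * ‖w‖ := norm_expForm_le
  set ρ' : ℝ := min (ρ / (Real.sqrt (Fintype.card ι) + 1)) (min 1 (c / 2) / (κ + 1)) with hρ'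
  have hρ'0 : 0 < ρ' := by positivity
  have hmemM : ∀ w : ι → ℂ, ‖w‖ ≤ ρ' → imVec (z + w) ∈ M := by
    intro w hw
    rw [hM, mem_closedBall, imVec_add, dist_eq_norm, add_sub_cancel_left]
    have h1 := norm_imVec_le w
    have h2 : ‖w‖ ≤ ρ / (Real.sqrt (Fintype.card ι) + 1) := hw.trans (min_le_left _ _)
    rw [le_div_iff₀ (by positivity)] at h2
    nlinarith [Real.sqrt_nonneg (Fintype.card ι : ℝ), norm_nonneg w]
  have hℓw : ∀ w : ι → ℂ, ‖w‖ ≤ ρ' → ‖expForm w‖ ≤ 1 ∧ ‖expForm w‖ ≤ c / 2 := by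
    intro w hw
    have h2 : ‖w‖ ≤ min 1 (c / 2) / (κ + 1) := hw.trans (min_le_right _ _)
    rw [le_div_iff₀ (by positivity)] at h2
    have h3 : ‖expForm w‖ ≤ min 1 (c / 2) := by nlinarith [hκw w, norm_nonneg w]
    exact ⟨h3.trans (min_le_left _ _), h3.trans (min_le_right _ _)⟩
  refine ⟨ρ', hρ'0, fun w hw => hball (hmemM w hw), fun m => ?_⟩
  have hCn := coneCutoffBound_nonneg S m.2
  refine ⟨4 ^ m.2 * coneCutoffBound S m.2 * (1 + ‖expForm z‖) ^ m.2 * Real.exp A * κ *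
      ((m.1 + 1).factorial / (c / 2) ^ (m.1 + 1) * Real.exp (c / 2)), by positivity,
    fun w hw => ?_⟩
  have hzw : imVec (z + w) ∈ interior (polarCone S) := hball (hmemM w hw)
  set R := laplaceKernel S (z + w) - laplaceKernel S z with hR
  have hfun : ⇑R = fun ξ => (coneCutoff S ξ : ℂ) * exp (expForm z ξ) * (exp (expForm w ξ) - 1) := by
    funext ξ
    simp only [hR, sub_apply, laplaceKernel_apply hzw, laplaceKernel_apply hz, expForm_add,
      add_apply, Complex.exp_add]
    ring
  have hC0 : 0 ≤ 4 ^ m.2 * coneCutoffBound S m.2 * (1 + ‖expForm z‖) ^ m.2 * Real.exp A *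
      ‖expForm w‖ := by positivity
  have hb : ∀ ξ, ‖iteratedFDeriv ℝ m.2 R ξ‖ ≤ 4 ^ m.2 * coneCutoffBound S m.2 *
      (1 + ‖expForm z‖) ^ m.2 * Real.exp A * ‖expForm w‖ * (1 + ‖ξ‖) ^ 1 *
        Real.exp (-(c / 2 * ‖ξ‖)) := fun ξ => by
    rw [hfun, pow_one]
    exact norm_iteratedFDeriv_cutoff_cexp_sub_le (contDiff_coneCutoff S)
      (fun i hi x => norm_iteratedFDeriv_coneCutoff_le S hi x) (expForm z) (hre z hzM)
      (expForm w) (hℓw w hw).1 (hℓw w hw).2 ξ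
  refine (seminorm_le_of_exp_bound R (half_pos hc) hC0 hb m.1).trans ?_
  calc 4 ^ m.2 * coneCutoffBound S m.2 * (1 + ‖expForm z‖) ^ m.2 * Real.exp A * ‖expForm w‖ *
        ((m.1 + 1).factorial / (c / 2) ^ (m.1 + 1) * Real.exp (c / 2))
      ≤ 4 ^ m.2 * coneCutoffBound S m.2 * (1 + ‖expForm z‖) ^ m.2 * Real.exp A * (κ * ‖w‖) *
        ((m.1 + 1).factorial / (c / 2) ^ (m.1 + 1) * Real.exp (c / 2)) := by
        gcongr
        exact hκw w
    _ = _ := by ring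

/-! ### The kernel along real directions -/

/-- The embedding of a real vector as a complex point. [folklore] -/
theorem norm_ofReal_fun_le (v : EuclideanSpace ℝ ι) : ‖(fun i => ((v i : ℝ) : ℂ))‖ ≤ ‖v‖ := by
  refine (pi_norm_le_iff_of_nonneg (norm_nonneg v)).2 fun i => ?_
  rw [Complex.norm_real]
  exact PiLp.norm_apply_le v i

omit [Fintype ι] in
/-- Translating the base point of a ray by a real vector. [folklore] -/
theorem rayPoint_add (x v y : EuclideanSpace ℝ ι) (t : ℝ) :
    rayPoint (x + v) y t = rayPoint x y t + fun i => ((v i : ℝ) : ℂ) := by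
  funext i
  simp only [rayPoint_apply, PiLp.add_apply, Complex.ofReal_add, Pi.add_apply]
  ring

/-- The sup norm of a ray point: `‖x + ity‖_∞ ≤ ‖x‖ + |t| ‖y‖`. [folklore] -/
theorem norm_rayPoint_le (x y : EuclideanSpace ℝ ι) (t : ℝ) :
    ‖rayPoint x y t‖ ≤ ‖x‖ + |t| * ‖y‖ := by
  refine (pi_norm_le_iff_of_nonneg (by positivity)).2 fun i => ?_
  rw [rayPoint_apply]
  calc ‖(x i : ℂ) + (t : ℂ) * I * (y i : ℂ)‖ ≤ ‖(x i : ℂ)‖ + ‖(t : ℂ) * I * (y i : ℂ)‖ :=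
        norm_add_le _ _
    _ = |x i| + |t| * |y i| := by simp [Complex.norm_real]
    _ ≤ ‖x‖ + |t| * ‖y‖ := by
        gcongr
        · exact (Real.norm_eq_abs _).symm.le.trans (PiLp.norm_apply_le x i)
        · exact (Real.norm_eq_abs _).symm.le.trans (PiLp.norm_apply_le y i)

/-- **Continuity of the kernel along real directions**: for `y` in the open cone and `t > 0`,
`x ↦ laplaceKernel S (x + ity)` is continuous into the Schwartz space. [folklore] -/
theorem continuous_laplaceKernel_rayPoint (S : Set (EuclideanSpace ℝ ι)) {y : EuclideanSpace ℝ ι}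
    (hy : y ∈ interior (polarCone S)) {t : ℝ} (ht : 0 < t) :
    Continuous fun x : EuclideanSpace ℝ ι => laplaceKernel S (rayPoint x y t) := by
  refine continuous_iff_continuousAt.2 fun x => ?_
  have hz : imVec (rayPoint x y t) ∈ interior (polarCone S) := by
    rw [imVec_rayPoint]
    exact smul_mem_interior_polarCone hy ht
  obtain ⟨ρ, hρ, -, hK⟩ := exists_seminorm_laplaceKernel_sub_le S hz
  rw [ContinuousAt, (schwartz_withSeminorms ℂ (EuclideanSpace ℝ ι) ℂ).tendsto_nhds]
  intro m ε hε
  obtain ⟨K, hK0, hKw⟩ := hK m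
  have hr : 0 < min ρ (ε / (2 * (K + 1))) := lt_min hρ (by positivity)
  have hev := Metric.closedBall_mem_nhds x hr
  filter_upwards [hev] with x' hx'
  rw [mem_closedBall, dist_eq_norm] at hx'
  set w : ι → ℂ := fun i => (((x' - x) i : ℝ) : ℂ) with hw
  have hwn : ‖w‖ ≤ ‖x' - x‖ := norm_ofReal_fun_le (x' - x)
  have hx'eq : rayPoint x' y t = rayPoint x y t + w := by
    rw [hw, ← rayPoint_add, add_sub_cancel]
  rw [schwartzSeminormFamily_apply, hx'eq]
  have hwρ : ‖w‖ ≤ ρ := hwn.trans (hx'.trans (min_le_left _ _))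
  calc SchwartzMap.seminorm ℂ m.1 m.2 (laplaceKernel S (rayPoint x y t + w) -
        laplaceKernel S (rayPoint x y t)) ≤ K * ‖w‖ := hKw w hwρ
    _ ≤ K * (ε / (2 * (K + 1))) := by
        gcongr
        exact hwn.trans (hx'.trans (min_le_right _ _))
    _ < ε := by
        rw [mul_div_assoc', div_lt_iff₀ (by positivity)]
        nlinarith

/-- **Polynomial growth of the kernel's seminorms along real directions**: for `y` in the open
cone and `t > 0`, `‖laplaceKernel S (x + ity)‖_{k,n} ≤ C (1 + ‖x‖)ⁿ`. [folklore] -/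
theorem exists_seminorm_laplaceKernel_rayPoint_le (S : Set (EuclideanSpace ℝ ι))
    {y : EuclideanSpace ℝ ι} (hy : y ∈ interior (polarCone S)) {t : ℝ} (ht : 0 < t) (k n : ℕ) :
    ∃ C : ℝ, ∀ x : EuclideanSpace ℝ ι,
      SchwartzMap.seminorm ℂ k n (laplaceKernel S (rayPoint x y t)) ≤ C * (1 + ‖x‖) ^ n := by
  have hty : t • y ∈ interior (polarCone S) := smul_mem_interior_polarCone hy ht
  obtain ⟨D, hD0, hD⟩ := exists_seminorm_laplaceKernel_le S isCompact_singleton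
    (singleton_subset_iff.2 hty) k n
  refine ⟨D * (1 + |t| * ‖y‖) ^ n, fun x => ?_⟩
  have hz : imVec (rayPoint x y t) ∈ ({t • y} : Set (EuclideanSpace ℝ ι)) := by
    rw [imVec_rayPoint]; exact mem_singleton _
  refine (hD _ hz).trans ?_
  have h1 : 1 + ‖rayPoint x y t‖ ≤ (1 + |t| * ‖y‖) * (1 + ‖x‖) := by
    have h := norm_rayPoint_le x y t
    nlinarith [h, mul_nonneg (mul_nonneg (abs_nonneg t) (norm_nonneg y)) (norm_nonneg x)]
  calc D * (1 + ‖rayPoint x y t‖) ^ n ≤ D * ((1 + |t| * ‖y‖) * (1 + ‖x‖)) ^ n := by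
        gcongr
    _ = D * (1 + |t| * ‖y‖) ^ n * (1 + ‖x‖) ^ n := by rw [mul_pow]; ring

end Literature.Analysis.Distribution
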